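import Mathlib
import Summits.BirchSwinnertonDyer.BirchSwinnertonDyer.Theorems.ResidualThetaTransportAtTwoSignedMuSeedAtTwoPlusNonsquareDescentTowerNorms
import Summits.BirchSwinnertonDyer.BirchSwinnertonDyer.Theorems.SignedLowerHalvesSprungLowerDivisibilityAtThreeRobustBezout
import HarnessLib

/-!
# Non-square descent — IWASAWA GROWTH AT `μ = 0`, PART I: `ω_n = (1+T)^{pⁿ} − 1` CONTRACTS A MODULE ON WHICH `T` IS TOPOLOGICALLY
# NILPOTENT (`ω_n M ⊆ p^j M` for `n ≫ 0`) — the module-level growth lemma of stub S2 of the line card `nonsquare-descent`, seed crux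
# `SignedMuSeedAtTwoPlus` stmt-BirchSwinnertonDyer-21438 (parent Kμ⁺ `SignedMuVanishingAtTwoPlus` stmt-BirchSwinnertonDyer-20689, route
# ResidualThetaTransportAtTwo)

Cell `bsd-wall`, width seat `bsd-wall-rtt-p4-w2` g18 (`--supports`, closes nothing).  THEOREMS ONLY; BSD is not proved by this and
nothing arithmetic is asserted: commutative algebra over an arbitrary commutative ring.

Stub S2 of `Cruxes/SignedMuSeedAtTwoPlus/Lines/nonsquare-descent.md` ends with «the growth lemma giving `μ(X^χ) ≤ μ(Q')`», Leans on: «Iwasawa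
growth lemma (tree `ClassicalMuInvariant` style)».  The tree has Iwasawa's growth theorem only as a NAMED FACT about class numbers
(`Literature.NumberTheory.IwasawaTheory.iwasawa1959_classNumberPExp_growth`); for MODULES nothing is in the tree.  What the chain needs is the
`μ = 0` case: «`μ(Q') = 0` ⟹ `#(Q'/ω_nQ')` grows (at most) linearly in the exponent».  This file and its sequel
(`Theorems/…NonsquareDescentGrowthLinear.lean`) PROVE that case in elementary module form, for every `p` (including `p = 2`) and every
coefficient ring: if `T` is topologically nilpotent modulo `p` on `M` (`T^N M ⊆ pM` — for a f.g. torsion `Λ`-module this IS `μ = 0`) then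
`ω_n M ⊆ p^j M` for `n + 1 ≥ N j` (this file), whence `ω_{n+1} M = p·ω_n M` for `n ≫ 0` by Nakayama and `#(M/ω_{n+1}M) = #(M/ω_nM)·c`
with `c` constant (sequel).  Dictionary: `R = Λ' = 𝒪⟦T⟧` (any commutative ring here), `p` the residue characteristic as a natural number,
`ω_n = (1+T)^{pⁿ} − 1`, `ν_n = ∑_{i<p} (1+T)^{pⁿ i}` (`ω_{n+1} = ν_n ω_n`, `…TowerNorms`), `M = Q'`.

* §1 `(I ⊔ J)ⁿ ≤ I ⊔ Jⁿ` for ideals — the tree theorem `…Theorems.ChromaticRobustBezout.sup_pow_le_sup_pow` (cited, imported).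
* §2 **`omega_mem_maximal_pow`** — `ω_n ∈ (p, T)^{n+1}` (induction via `ω_{n+1} = ν_n ω_n`, `ν_n ≡ p mod ω_n`).
* §3 `maximal_pow_smul_le`, `maximal_pow_mul_smul_le` — `T^N S ⊆ pS ⟹ (p,T)^{N j} S ⊆ p^j S` for any submodule `S`;
  `T_pow_smul_le_of_smul` — the hypothesis is inherited by `r • S`.
* §4 **`omega_smul_le_pow_smul`** — `T^N S ⊆ pS`, `N j ≤ n + 1 ⟹ ω_n S ⊆ p^j S`: the contraction.

[folklore]
-/

set_option autoImplicit false
-- the Theorems namespace of this sub repeats the summit name by design (D-0017 nested layout)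
set_option linter.dupNamespace false

open Finset
open scoped Pointwise

namespace Summit.BirchSwinnertonDyer.BirchSwinnertonDyer.Theorems.SignedMuAtTwo.NonsquareDescent

variable {R : Type*} [CommRing R]

/-! ## §1 `(I ⊔ J)ⁿ ≤ I ⊔ Jⁿ` is the tree theorem `…Theorems.ChromaticRobustBezout.sup_pow_le_sup_pow` (imported) -/

/-! ## §2 `ω_n ∈ (p, T)^{n+1}` -/

/-- **`ω_n = (1+T)^{pⁿ} − 1 ∈ (p, T)^{n+1}`** for every natural number `p` and every `T`: `ω_0 = T`, and `ω_{n+1} = ν_n·ω_n` with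
`ν_n = ∑_{i<p}(1+T)^{pⁿ i} ≡ p (mod ω_n)`, so `ν_n ∈ (p, T)`. [folklore] -/
theorem omega_mem_maximal_pow (p : ℕ) (T : R) (n : ℕ) :
    (1 + T) ^ (p ^ n) - 1 ∈ (Ideal.span {(p : R), T}) ^ (n + 1) := by
  induction n with
  | zero =>
    have hT : T ∈ Ideal.span {(p : R), T} := Ideal.subset_span (by simp)
    simpa using hT
  | succ n ih =>
    have hfac : (1 + T) ^ (p ^ (n + 1)) - 1 =
        (∑ i ∈ range p, (1 + T) ^ (p ^ n * i)) * ((1 + T) ^ (p ^ n) - 1) := by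
      rw [pow_succ]
      exact pow_mul_sub_one_eq_geom_sum_mul (1 + T) (p ^ n) p
    have hν : (∑ i ∈ range p, (1 + T) ^ (p ^ n * i)) ∈ Ideal.span {(p : R), T} := by
      obtain ⟨q, hq⟩ := sub_one_dvd_geom_sum_sub_natCast (1 + T) (p ^ n) p
      have h1 : (∑ i ∈ range p, (1 + T) ^ (p ^ n * i)) = (p : R) + ((1 + T) ^ (p ^ n) - 1) * q := by
        rw [← hq]; ring
      rw [h1]
      refine Submodule.add_mem _ (Ideal.subset_span (by simp)) (Ideal.mul_mem_right _ _ ?_)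
      exact Ideal.pow_le_self (Nat.succ_ne_zero n) ih
    rw [hfac, pow_succ']
    exact Ideal.mul_mem_mul hν ih

/-! ## §3 `T^N S ⊆ pS ⟹ (p, T)^{Nj} S ⊆ p^j S` -/

section Contraction

variable {M : Type*} [AddCommGroup M] [Module R M]

/-- `(p, T)^N • S ≤ p • S` as soon as `T^N • S ≤ p • S` (all other monomials of `(p,T)^N` carry a factor `p`). [folklore] -/
theorem maximal_pow_smul_le (p : ℕ) (T : R) (S : Submodule R M) (N : ℕ)
    (hT : Ideal.span {T ^ N} • S ≤ Ideal.span {(p : R)} • S) :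
    (Ideal.span {(p : R), T}) ^ N • S ≤ Ideal.span {(p : R)} • S := by
  have hsplit : Ideal.span {(p : R), T} = Ideal.span {(p : R)} ⊔ Ideal.span {T} := by
    rw [← Ideal.span_union, Set.singleton_union]
  rw [hsplit]
  refine (Submodule.smul_mono_left (ChromaticRobustBezout.sup_pow_le_sup_pow _ _ N)).trans ?_
  rw [Ideal.span_singleton_pow, Submodule.sup_smul]
  exact sup_le le_rfl hT

/-- Iterating: `T^N • S ≤ p • S ⟹ (p, T)^{N j} • S ≤ p^j • S`. [folklore] -/
theorem maximal_pow_mul_smul_le (p : ℕ) (T : R) (S : Submodule R M) (N : ℕ)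
    (hT : Ideal.span {T ^ N} • S ≤ Ideal.span {(p : R)} • S) (j : ℕ) :
    (Ideal.span {(p : R), T}) ^ (N * j) • S ≤ (Ideal.span {(p : R)}) ^ j • S := by
  induction j with
  | zero => rw [mul_zero, pow_zero, pow_zero]
  | succ j ih =>
    have e1 : (Ideal.span {(p : R), T}) ^ (N * (j + 1)) =
        (Ideal.span {(p : R), T}) ^ N * (Ideal.span {(p : R), T}) ^ (N * j) := by
      rw [Nat.mul_succ, pow_add, mul_comm ((Ideal.span {(p : R), T}) ^ (N * j))]
    rw [e1, Submodule.mul_smul]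
    calc (Ideal.span {(p : R), T}) ^ N • ((Ideal.span {(p : R), T}) ^ (N * j) • S)
        ≤ (Ideal.span {(p : R), T}) ^ N • ((Ideal.span {(p : R)}) ^ j • S) := Submodule.smul_mono le_rfl ih
      _ = (Ideal.span {(p : R)}) ^ j • ((Ideal.span {(p : R), T}) ^ N • S) := by
          rw [← Submodule.mul_smul, mul_comm ((Ideal.span {(p : R), T}) ^ N) ((Ideal.span {(p : R)}) ^ j),
            Submodule.mul_smul]
      _ ≤ (Ideal.span {(p : R)}) ^ j • (Ideal.span {(p : R)} • S) :=
          Submodule.smul_mono le_rfl (maximal_pow_smul_le p T S N hT)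
      _ = (Ideal.span {(p : R)}) ^ (j + 1) • S := by
          rw [← Submodule.mul_smul, ← pow_succ]

/-- The hypothesis `T^N • S ≤ p • S` is inherited by every `r • S` (e.g. `S' = ω_n • S`). [folklore] -/
theorem T_pow_smul_le_of_smul (p : ℕ) (T : R) (S : Submodule R M) (N : ℕ)
    (hT : Ideal.span {T ^ N} • S ≤ Ideal.span {(p : R)} • S) (r : R) :
    Ideal.span {T ^ N} • (Ideal.span {r} • S) ≤ Ideal.span {(p : R)} • (Ideal.span {r} • S) := by
  have e1 : Ideal.span {T ^ N} • (Ideal.span {r} • S) = Ideal.span {r} • (Ideal.span {T ^ N} • S) := by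
    rw [← Submodule.mul_smul, mul_comm (Ideal.span {T ^ N}) (Ideal.span {r}), Submodule.mul_smul]
  have e2 : Ideal.span {(p : R)} • (Ideal.span {r} • S) = Ideal.span {r} • (Ideal.span {(p : R)} • S) := by
    rw [← Submodule.mul_smul, mul_comm (Ideal.span {(p : R)}) (Ideal.span {r}), Submodule.mul_smul]
  rw [e1, e2]
  exact Submodule.smul_mono le_rfl hT

/-! ## §4 The contraction `ω_n S ⊆ p^j S` -/

/-- **`ω_n` contracts: `T^N • S ≤ p • S` and `N j ≤ n + 1` ⟹ `ω_n • S ≤ p^j • S`.**  («on a module with `μ = 0`, `ω_n = γ^{pⁿ} − 1` acts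
divisibly by any prescribed power of `p` from some level on».) [folklore] -/
theorem omega_smul_le_pow_smul (p : ℕ) (T : R) (S : Submodule R M) (N : ℕ)
    (hT : Ideal.span {T ^ N} • S ≤ Ideal.span {(p : R)} • S) {j n : ℕ} (hn : N * j ≤ n + 1) :
    Ideal.span {(1 + T) ^ (p ^ n) - 1} • S ≤ (Ideal.span {(p : R)}) ^ j • S := by
  refine (Submodule.smul_mono_left ?_).trans (maximal_pow_mul_smul_le p T S N hT j)
  rw [Ideal.span_singleton_le_iff_mem]
  exact Ideal.pow_le_pow_right hn (omega_mem_maximal_pow p T n)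

/-- The same with `p^j` as a single generator: `ω_n • S ≤ (p^j) • S`. [folklore] -/
theorem omega_smul_le_span_pow_smul (p : ℕ) (T : R) (S : Submodule R M) (N : ℕ)
    (hT : Ideal.span {T ^ N} • S ≤ Ideal.span {(p : R)} • S) {j n : ℕ} (hn : N * j ≤ n + 1) :
    Ideal.span {(1 + T) ^ (p ^ n) - 1} • S ≤ Ideal.span {(p : R) ^ j} • S := by
  rw [← Ideal.span_singleton_pow]
  exact omega_smul_le_pow_smul p T S N hT hn

/-- Elementwise reading: under `T^N • S ≤ p • S` and `N j ≤ n + 1`, every `ω_n • x` (`x ∈ S`) is `p^j • y` with `y ∈ S`. [folklore] -/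
theorem exists_omega_smul_eq_pow_smul (p : ℕ) (T : R) (S : Submodule R M) (N : ℕ)
    (hT : Ideal.span {T ^ N} • S ≤ Ideal.span {(p : R)} • S) {j n : ℕ} (hn : N * j ≤ n + 1)
    {x : M} (hx : x ∈ S) : ∃ y ∈ S, ((1 + T) ^ (p ^ n) - 1) • x = (p : R) ^ j • y := by
  have h1 : ((1 + T) ^ (p ^ n) - 1) • x ∈ Ideal.span {(p : R) ^ j} • S :=
    omega_smul_le_span_pow_smul p T S N hT hn (Submodule.smul_mem_smul (Ideal.mem_span_singleton_self _) hx)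
  rw [Submodule.ideal_span_singleton_smul, Submodule.mem_smul_pointwise_iff_exists] at h1
  obtain ⟨y, hy, hyx⟩ := h1
  exact ⟨y, hy, hyx.symm⟩

end Contraction

end Summit.BirchSwinnertonDyer.BirchSwinnertonDyer.Theorems.SignedMuAtTwo.NonsquareDescent
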